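import Mathlib
import Summits.Ventures.PercRepro2.Defs
import Summits.Ventures.PercRepro2.Graph
import Summits.Ventures.PercRepro2.Induced
import Summits.Ventures.PercRepro2.VdBKahn
import Summits.Ventures.PercRepro2.ReimerVdBK

/-!
# The twisted (R-1.2): forced edges blue on the left, red on the right
(blind cell PercRepro2, mine-c g45; `conjectures/MINE-C.md` §54.7)

EAR-AMPLIFICATION of (R-1.2): replace an edge `{u, w}` by `k` «ears» — new vertices adjacent to `u` and `w`,
all put into `B`.  On the left side an ear is admissible iff it lies in world 2, on the right side iff it lies
in world 1; as `k → ∞` the leading term `3^k` of each side comes from the configurations in which the ear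
edge is, in effect, FORCED: blue on the left, red on the right.  The coefficient of `3^k` is therefore the
TWISTED count pair below, and (R-1.2) on the amplified graphs forces the twisted inequality.  With
`X ∩ Y = ∅` the twisted inequality is Harris (`twisted_of_disjoint`, the general abstract form
`count_inter_bar_le_count_inter`: for upper sets `U₁, U₂`, `#(U₁ ∩ bar U₂) ≤ #(U₁ ∩ U₂)`); with `X ∩ Y ≠ ∅` it
is the open conjecture `TwistedRvdBK` (0 violations on every graph with ≤ 6 vertices and every rooted
7-vertex class with 8–12 edges for one forced root edge; the tight instances have slack exactly 1, so the
slack of (R-1.2) is not uniformly positive — any proof must be exact).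
-/

namespace Summit.Ventures.PercRepro2

namespace ReimerVdBK

open Classical

variable {V : Type*} {E : Type*} [Fintype E] [DecidableEq E] [Fintype V] [DecidableEq V]

/-! ## Upper sets and their bars -/

omit [Fintype E] [DecidableEq E] [Fintype V] [DecidableEq V] in
/-- `allOpen F` is an upper set. -/
lemma isUpperSet_allOpen (F : Finset E) : IsUpperSet (allOpen F) := by
  intro ω ω' h hω e he
  have := h e
  rw [hω e he] at this
  exact Bool.le_iff_imp.1 this rfl

omit [Fintype E] [DecidableEq E] [Fintype V] [DecidableEq V] in
/-- The bar of «all open on `F`» is «all closed on `F`». -/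
lemma bar_allOpen (F : Finset E) : bar (allOpen F) = allClosed F := by
  ext ω
  simp only [mem_bar, allOpen, allClosed, Set.mem_setOf_eq, compl]
  constructor
  · intro h e he; have := h e he; simpa using this
  · intro h e he; rw [h e he]; rfl

omit [Fintype V] [DecidableEq V] in
/-- **Harris at `p = 1/2`, the abstract three-step form**: for upper sets `U₁`, `U₂`,
`#(U₁ ∩ bar U₂) ≤ #(U₁ ∩ U₂)` — `U₁ ∩ bar U₂` is (upper) ∩ (lower), `bar` preserves counts, and two upper
sets are positively correlated. -/
theorem count_inter_bar_le_count_inter {U₁ U₂ : Set (Config E)} (hU₁ : IsUpperSet U₁)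
    (hU₂ : IsUpperSet U₂) : count (U₁ ∩ bar U₂) ≤ count (U₁ ∩ U₂) := by
  have hL : IsLowerSet (bar U₂) := isLowerSet_bar_of_isUpperSet hU₂
  have h1 := count_inter_le_of_isLowerSet hL hU₁
  have h2 := count_mul_count_le_of_isUpperSet hU₁ hU₂
  have h3 : count (bar U₂) = count U₂ := count_bar U₂
  have hpos : (0 : ℚ) < (1 / 2 : ℚ) ^ Fintype.card E := by positivity
  have key : (count (U₁ ∩ bar U₂) : ℚ) * (1 / 2 : ℚ) ^ Fintype.card E ≤
      (count (U₁ ∩ U₂) : ℚ) * (1 / 2 : ℚ) ^ Fintype.card E := by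
    calc (count (U₁ ∩ bar U₂) : ℚ) * (1 / 2 : ℚ) ^ Fintype.card E
        = (count (bar U₂ ∩ U₁) : ℚ) * (1 / 2 : ℚ) ^ Fintype.card E := by rw [Set.inter_comm]
      _ ≤ (count (bar U₂) : ℚ) * (count U₁ : ℚ) * ((1 / 2 : ℚ) ^ Fintype.card E) ^ 2 := h1
      _ = (count U₁ : ℚ) * (count U₂ : ℚ) * ((1 / 2 : ℚ) ^ Fintype.card E) ^ 2 := by rw [h3]; ring
      _ ≤ (count (U₁ ∩ U₂) : ℚ) * (1 / 2 : ℚ) ^ Fintype.card E := h2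
  exact_mod_cast le_of_mul_le_mul_right key hpos

/-! ## The twisted counts -/

variable (ends : E → Sym2 V) (s : V)

/-- The left twisted event: the two-world event of `(A, X; B, Y)` with every edge of `F` blue. -/
def twistedL (A X B Y : Finset V) (F : Finset E) : Set (Config E) :=
  twoWorld ends s A X B Y ∩ allClosed F

/-- The right twisted event: the two-world event of `(A ∪ B, X ∩ Y; ∅, X ∪ Y)` with every edge of `F` red. -/
def twistedR (A X B Y : Finset V) (F : Finset E) : Set (Config E) :=
  twoWorld ends s (A ∪ B) (X ∩ Y) ∅ (X ∪ Y) ∩ allOpen F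

/-- **The twisted (R-1.2)** (conjecture for `X ∩ Y ≠ ∅`, `MINE-C.md` §54.7): `#{ω ∈ L : F blue} ≤ #{ω ∈ R : F red}`.
It is the coefficient of `3^k` in (R-1.2) on the graph with `k` ears (tips in `B`) on each edge of `F`, hence
a consequence of (R-1.2); `F = ∅` is (R-1.2) itself. -/
def TwistedRvdBK (A X B Y : Finset V) (F : Finset E) : Prop :=
  count (twistedL ends s A X B Y F) ≤ count (twistedR ends s A X B Y F)

omit [Fintype V] in
/-- With no forced edge the twisted statement is (R-1.2). -/
lemma twistedRvdBK_empty_iff (A X B Y : Finset V) :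
    TwistedRvdBK ends s A X B Y ∅ ↔ RvdBK ends s A X B Y := by
  unfold TwistedRvdBK twistedL twistedR RvdBK reimerCount
  have h1 : allClosed (∅ : Finset E) = Set.univ := by ext ω; simp [allClosed]
  have h2 : allOpen (∅ : Finset E) = Set.univ := by ext ω; simp [allOpen]
  rw [h1, h2, Set.inter_univ, Set.inter_univ]

omit [Fintype V] in
/-- **The twisted (R-1.2) when the avoided sets are disjoint**: for `X ∩ Y = ∅` and EVERY `F`,
`#{ω ∈ L : F blue} ≤ #{ω ∈ R : F red}` — Harris, exactly as `rvdBK_of_disjoint`, with the upper set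
`Q_B ∩ bar R_X` replaced by `Q_B ∩ bar R_X ∩ allOpen F`. -/
theorem twisted_of_disjoint (A X B Y : Finset V) (F : Finset E) (hXY : X ∩ Y = ∅) :
    TwistedRvdBK ends s A X B Y F := by
  unfold TwistedRvdBK twistedL twistedR twoWorld
  rw [hXY, avoidAll_empty, connAll_empty, Set.inter_univ, Set.univ_inter]
  set QA := connAll ends s A with hQA
  set QB := connAll ends s B with hQB
  set RX := avoidAll ends s X with hRX
  set RY := avoidAll ends s Y with hRY
  have hU1 : IsUpperSet (QA ∩ bar RY) :=
    (isUpperSet_connAll ends s A).inter (isUpperSet_bar_of_isLowerSet (isLowerSet_avoidAll ends s Y))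
  have hU2 : IsUpperSet ((QB ∩ bar RX) ∩ allOpen F) :=
    ((isUpperSet_connAll ends s B).inter
      (isUpperSet_bar_of_isLowerSet (isLowerSet_avoidAll ends s X))).inter (isUpperSet_allOpen F)
  -- the left event is `U₁ ∩ bar U₂`
  have hW : ((QA ∩ RX) ∩ bar (QB ∩ RY)) ∩ allClosed F =
      (QA ∩ bar RY) ∩ bar ((QB ∩ bar RX) ∩ allOpen F) := by
    rw [bar_inter, bar_inter, bar_inter, bar_bar, bar_allOpen]
    ext ω; simp only [Set.mem_inter_iff]; tauto
  -- the right event is `U₁ ∩ U₂`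
  have hR : (connAll ends s (A ∪ B) ∩ bar (avoidAll ends s (X ∪ Y))) ∩ allOpen F =
      (QA ∩ bar RY) ∩ ((QB ∩ bar RX) ∩ allOpen F) := by
    rw [connAll_union, avoidAll_union, bar_inter]
    ext ω; simp only [Set.mem_inter_iff]; tauto
  rw [hW, hR]
  exact count_inter_bar_le_count_inter hU1 hU2

end ReimerVdBK

end Summit.Ventures.PercRepro2
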